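import Summits.CriticalPhenomena.SAWScalingLimit.Theorems.SAWLoopFugacityFlowSimpleSubseqLimitsPastFuturePinned
import Summits.CriticalPhenomena.SAWScalingLimit.Theorems.SAWLoopFugacityFlowAvoidancePassage
import Summits.CriticalPhenomena.SAWScalingLimit.Theorems.SAWLoopFugacityFlowSLEAvoidanceValue
import Summits.CriticalPhenomena.SAWScalingLimit.Theorems.SAWLoopFugacityFlowAssembly
import Summits.CriticalPhenomena.SAWScalingLimit.Theorems.SAWLoopFugacityFlowSLECarrier
import Summits.CriticalPhenomena.SAWScalingLimit.Theorems.SAWLoopFugacityFlowAvoidanceDeterminesLaw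
import HarnessLib

/-!
# The crux `SimpleSubseqLimits` INSIDE its routes: the residual is first-entrance slit avoidance alone
(crux stmt-CriticalPhenomena-4982, decl
`Summit.CriticalPhenomena.SAWScalingLimit.Theses.SAWLoopFugacityFlow.SimpleSubseqLimits`; line
`past-shadowing-costs-halves` v4; line lead c5, 2026-08-17)

The A-side-free lattice line (c3/c4) closes the crux from TWO research-open lattice inputs,
`PastFutureAvoidance` (ORDER: the critical SAW avoids its own far past at first entrances) and
`BoundaryDecay` (BOUNDARY: it avoids `∂Ω` away from the marked points), and pins both
(`FarPast.Pinned.crux_iff_pastFuture : EventualTight → (S ↔ PastFutureAvoidance ∧ BoundaryDecay)`).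

This file records what the crux costs INSIDE the routes that want it. Every such route also carries the
A-side crux `AvoidanceLimit` (stmt-10649) and tightness `EventualTight` (stmt-1372) as hypotheses of its
deciding theorem, and the two A-side supports `AvoidancePassage` (stmt-4984) and `SLEAvoidanceValue`
(stmt-10651) are THEOREMS of the tree (`avoidancePassage_proof`, `SLEAvoidanceValue_proof`). Hence:

* `boundaryDecay_of_avoidanceLimit` — `EventualTight → AvoidanceLimit → BoundaryDecay`: the BOUNDARY input
  is not an extra cost inside the routes (c3's `Boundary.Line.boundaryDecay_of_routeItems` with the two
  supports discharged);
* `line_pastFuture_avoidanceLimit` — `PastFutureAvoidance → AvoidanceLimit → SimpleSubseqLimits`, with NO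
  tightness: simplicity `ν`-a.e. from the ORDER input alone (`FarPast.Passage.ae_simple_of_farReturnDecayAt`,
  guarded Rohde–Schramm one level down, no SHAPE), the boundary clause `ν`-a.e. from the A-side SHAPE
  (`PastShadowing.Main.rangeArc_of_avoidanceValues`), endpoints and confinement free
  (`Negative.simpleSubseqLimits_iff_core`);
* `crux_iff_pastFutureAvoidance` — **`EventualTight → AvoidanceLimit → (SimpleSubseqLimits ↔ PastFutureAvoidance)`**:
  inside every route proving the A-side and tightness the crux IS first-entrance slit avoidance, nothing
  more and nothing less;
* `closes_of_pastFutureAvoidance` — the route's deciding chain re-run with the crux REPLACED by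
  `PastFutureAvoidance`: `AvoidanceLimit → PastFutureAvoidance → EventualTight → AvoidanceDeterminesLaw →
  SLECarrier → Assembly → SAWScalingLimit` (the planner may restate the item as `PastFutureAvoidance` —
  pasteable route-vocabulary text: the first conjunct of `FarPast.Pinned.SlitAvoidanceItem` — without
  touching the route's glue).
-/

noncomputable section

open MeasureTheory Filter Topology Set Metric Function
open Literature.Probability.RandomPlanarGeometry Literature.Probability.RandomPlanarGeometry.SAW
open Literature.Probability.LatticeModels
open scoped ENNReal NNReal BoundedContinuousFunction unitInterval

namespace Summit.CriticalPhenomena.SAWScalingLimit.Theorems.SimpleSubseqLimits.FarPast.RouteResidual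

open Summit.CriticalPhenomena.SAWScalingLimit.Theses.SAWLoopFugacityFlow
  (SimpleSubseqLimits AvoidanceLimit AvoidancePassage SLEAvoidanceValue EventualTight
    AvoidanceDeterminesLaw SLECarrier Assembly)
open Summit.CriticalPhenomena.SAWScalingLimit.Theorems (avoidancePassage_proof SLEAvoidanceValue_proof)
open Summit.CriticalPhenomena.SAWScalingLimit.Theorems.SimpleSubseqLimits.Negative
  (simpleSubseqLimits_iff_core)
open Summit.CriticalPhenomena.SAWScalingLimit.Theorems.SimpleSubseqLimits.MarkedPointRevisit.Passage
  (IsSubseqLimit)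
open Summit.CriticalPhenomena.SAWScalingLimit.Theorems.SimpleSubseqLimits.PastShadowing.Main
  (AvoidanceValues rangeArc_of_avoidanceValues avoidanceValues_of_routeItems)
open Summit.CriticalPhenomena.SAWScalingLimit.Theorems.SimpleSubseqLimits.Boundary.Passage (BoundaryDecay)
open Summit.CriticalPhenomena.SAWScalingLimit.Theorems.SimpleSubseqLimits.Boundary.Line
  (boundaryDecay_of_routeItems)
open Summit.CriticalPhenomena.SAWScalingLimit.Theorems.SimpleSubseqLimits.FarPast.Passage
  (FarReturnDecay ae_simple_of_farReturnDecayAt)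
open Summit.CriticalPhenomena.SAWScalingLimit.Theorems.SimpleSubseqLimits.FarPast.Line
  (PastFutureAvoidance farReturnDecay_of_pastFutureAvoidance)
open Summit.CriticalPhenomena.SAWScalingLimit.Theorems.SimpleSubseqLimits.FarPast.Pinned
  (pastFutureAvoidance_of_crux)

/-! ## §1 The A-side supports are theorems: the SHAPE input from `AvoidanceLimit` alone -/

/-- **Hull-avoidance values of subsequential limits from the A-side crux alone**: the two supports
`AvoidancePassage` (stmt-4984) and `SLEAvoidanceValue` (stmt-10651) entering
`PastShadowing.Main.avoidanceValues_of_routeItems` are discharged by their tree proofs. [folklore] -/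
theorem avoidanceValues_of_avoidanceLimit (hA : AvoidanceLimit) : AvoidanceValues :=
  avoidanceValues_of_routeItems hA avoidancePassage_proof SLEAvoidanceValue_proof

/-- **The BOUNDARY input is free inside the routes**: `EventualTight → AvoidanceLimit → BoundaryDecay`
(c3's `Boundary.Line.boundaryDecay_of_routeItems`, supports discharged). [folklore] -/
theorem boundaryDecay_of_avoidanceLimit (hT : EventualTight) (hA : AvoidanceLimit) : BoundaryDecay :=
  boundaryDecay_of_routeItems hT hA avoidancePassage_proof SLEAvoidanceValue_proof

/-! ## §2 The line inside the routes: ORDER input + A-side, no tightness -/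

/-- **The crux from first-entrance slit avoidance and the A-side crux, WITHOUT tightness.** Simplicity
`ν`-a.e. comes from the ORDER input alone (far-return decay ⇐ past/future avoidance; guarded
Rohde–Schramm one level down — no SHAPE is used for simplicity), the boundary clause `ν`-a.e. from the
A-side SHAPE (`rangeArc_of_avoidanceValues`), and the endpoint/confinement clauses are free. [folklore] -/
theorem line_pastFuture_avoidanceValues (hP : PastFutureAvoidance) (hAV : AvoidanceValues) :
    SimpleSubseqLimits := by
  have hF : FarReturnDecay := farReturnDecay_of_pastFutureAvoidance hP
  refine simpleSubseqLimits_iff_core.2 fun D a b hab s ν hs hν hw => ?_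
  have hsimple := ae_simple_of_farReturnDecayAt hab (hF D a b hab) (⟨hs, hν, hw⟩ : IsSubseqLimit D a b s ν)
  have hshape := rangeArc_of_avoidanceValues hAV D a b hab s ν hs hν hw
  filter_upwards [hsimple, hshape] with c h1 h2
  exact ⟨h1, h2.2⟩

/-- **The crux from first-entrance slit avoidance and `AvoidanceLimit` (stmt-10649) alone** — the
analogue for the cleanest ORDER typing of c2's `FirstHit.Line.line_firstHit` and the first lead's
`MarkedPointRevisit.Main.line_main`, with the two A-side supports discharged by their tree proofs and
no tightness hypothesis. [folklore] -/
theorem line_pastFuture_avoidanceLimit (hP : PastFutureAvoidance) (hA : AvoidanceLimit) :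
    SimpleSubseqLimits :=
  line_pastFuture_avoidanceValues hP (avoidanceValues_of_avoidanceLimit hA)

/-! ## §3 The residual certificate inside the routes -/

/-- **RESIDUAL OF THE CRUX INSIDE ITS ROUTES.** Under tightness (stmt-1372) and the A-side crux
(stmt-10649) — both hypotheses of every deciding theorem that consumes this crux — the crux IS
first-entrance slit avoidance: `SimpleSubseqLimits ↔ PastFutureAvoidance`. (`→`: necessity given
tightness, `FarPast.Pinned.pastFutureAvoidance_of_crux`; `←`: §2, which does not even use tightness.)
[folklore] -/
theorem crux_iff_pastFutureAvoidance (hT : EventualTight) (hA : AvoidanceLimit) :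
    SimpleSubseqLimits ↔ PastFutureAvoidance :=
  ⟨fun hS => pastFutureAvoidance_of_crux hT hS, fun hP => line_pastFuture_avoidanceLimit hP hA⟩

/-- The same with the route-neutral SHAPE input in place of `AvoidanceLimit` (for routes delivering the
hull-avoidance values of subsequential limits by another mechanism). [folklore] -/
theorem crux_iff_pastFutureAvoidance' (hT : EventualTight) (hAV : AvoidanceValues) :
    SimpleSubseqLimits ↔ PastFutureAvoidance :=
  ⟨fun hS => pastFutureAvoidance_of_crux hT hS, fun hP => line_pastFuture_avoidanceValues hP hAV⟩

/-! ## §4 The route's deciding chain with the crux replaced by its residual -/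

/-- **Route SAWLoopFugacityFlow closes with `PastFutureAvoidance` in place of `SimpleSubseqLimits`.**
The deciding theorem `Theses.SAWLoopFugacityFlow.closes` consumes the crux only through `Assembly`
(`SLECarrier → SLEAvoidanceValue → AvoidanceLimit → EventualTight → SimpleSubseqLimits → AvoidancePassage →
AvoidanceDeterminesLaw → SAWScalingLimit`); feeding it `line_pastFuture_avoidanceLimit` gives the summit
conjunct from the A-side crux, the ORDER input, tightness, and the remaining (proved or assumed) supports.
[folklore] -/
theorem closes_of_pastFutureAvoidance (hA : AvoidanceLimit) (hP : PastFutureAvoidance)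
    (hT : EventualTight) (hDet : AvoidanceDeterminesLaw) (hCar : SLECarrier) (hAsm : Assembly) :
    _root_.SAWScalingLimit :=
  hAsm hCar SLEAvoidanceValue_proof hA hT (line_pastFuture_avoidanceLimit hP hA) avoidancePassage_proof hDet

/-- **Registered form (stub `stub_routeResidual` of the crux item stmt-CriticalPhenomena-4982).** Inside
every route carrying tightness (stmt-1372) and the A-side crux `AvoidanceLimit` (stmt-10649) the crux
`SimpleSubseqLimits` is EQUIVALENT to first-entrance slit avoidance `PastFutureAvoidance`. [folklore] -/
theorem stub_routeResidual : EventualTight → AvoidanceLimit → (SimpleSubseqLimits ↔ PastFutureAvoidance) :=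
  fun hT hA => crux_iff_pastFutureAvoidance hT hA

/-! ## §5 The summit conjunct from exactly three open inputs (appended, lead c5) -/

/-- **THE PROGRAMME'S RESIDUAL ALONG THIS ROUTE, IN ONE LINE.** The summit conjunct `SAWScalingLimit`
(critical `δℤ²` SAW → chordal SLE_{8/3}) follows from exactly THREE research-open inputs — the A-side
restriction law `AvoidanceLimit` (stmt-10649), first-entrance slit avoidance `PastFutureAvoidance` (the
residual of this crux), and tightness `EventualTight` (stmt-1372) — everything else on the route being a
THEOREM of the tree: `SLECarrier_proof`, `SLEAvoidanceValue_proof`, `avoidancePassage_proof`,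
`AvoidanceDeterminesLaw_proof`, `Assembly_proof`, and §2 of this file for the crux itself. [folklore] -/
theorem sawScalingLimit_of_three_inputs (hA : AvoidanceLimit) (hP : PastFutureAvoidance)
    (hT : EventualTight) : _root_.SAWScalingLimit :=
  closes_of_pastFutureAvoidance hA hP hT
    Summit.CriticalPhenomena.SAWScalingLimit.Theorems.AvoidanceDeterminesLaw.AvoidanceDeterminesLaw_proof
    Summit.CriticalPhenomena.SAWScalingLimit.Theorems.SLECarrier_proof
    Summit.CriticalPhenomena.SAWScalingLimit.Theorems.Assembly_proof

/-- The same with the crux itself in place of its residual: `AvoidanceLimit → SimpleSubseqLimits →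
EventualTight → SAWScalingLimit` (the route's deciding theorem `closes` with its two idle hypotheses
`IsingBoundaryRatio`, `SubseqIdentification` dropped and its five proved items discharged). [folklore] -/
theorem sawScalingLimit_of_crux (hA : AvoidanceLimit) (hS : SimpleSubseqLimits) (hT : EventualTight) :
    _root_.SAWScalingLimit :=
  Summit.CriticalPhenomena.SAWScalingLimit.Theorems.Assembly_proof
    Summit.CriticalPhenomena.SAWScalingLimit.Theorems.SLECarrier_proof SLEAvoidanceValue_proof hA hT hS
    avoidancePassage_proof
    Summit.CriticalPhenomena.SAWScalingLimit.Theorems.AvoidanceDeterminesLaw.AvoidanceDeterminesLaw_proof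

/-- **Registered form (stub `stub_threeInputs` of the crux item stmt-CriticalPhenomena-4982).** The summit
conjunct from the three research-open inputs of the route: the A-side restriction law, first-entrance
slit avoidance, tightness. [folklore] -/
theorem stub_threeInputs : AvoidanceLimit → PastFutureAvoidance → EventualTight → _root_.SAWScalingLimit :=
  fun hA hP hT => sawScalingLimit_of_three_inputs hA hP hT

end Summit.CriticalPhenomena.SAWScalingLimit.Theorems.SimpleSubseqLimits.FarPast.RouteResidual

end
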